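import Summits.Ventures.PercRepro0.DualCut

/-!
# P6(a) «at least one»: a rectangle is crossed by `ω` or by its dual (seat p1, gen 1)

Second half of the Lean twin of P6-dualcrossing-p1-v1 §3 (Lemma 3.1), OFF the declaration path (lead
23:00:52Z), on the objects of `DualCut.lean` (`reach` = `K`, `cut` = `𝒦`, `dualCut` = `τ(𝒦)`):

  `LR_or_dual : ω ∈ LR_n ∨ dualConfig ω ∈ LR_n` for every configuration `ω` and every `n`.

(`dualConfig ω ∈ LR_n` is the event `TB*_n` of the paper file read through `ψ`: an open dual top–bottom
crossing of `B*_n` is a left–right crossing of `B_n` by the bonds `τ e` with `e` closed in `ω`, P6 Lemma 4.3.)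

Proof, as in the paper file, for `ω ∉ LR_n`: (iii) interior vertices `1 ≤ a ≤ n` of `B_n` have even degree in
`τ(𝒦)` (`even_edeg_interior`, the 4-cycle parity `even_xor_cycle`); (iv) a vertex `(n+1, b)` / `(0, b)` has
degree `[t_b ∈ 𝒦]` / `[u_b ∈ 𝒦]`, `t_b = {(b,n),(b+1,n)}`, `u_b = {(b,0),(b+1,0)}` (`edeg_top`, `edeg_bottom`);
vertices outside `B_n` have degree `0`; (v) the switch count along the top row is odd (`odd_card_top`, from
`odd_switch_count`); (vi) the odd-path lemma `exists_reachable_of_odd` yields a walk in `τ(𝒦)` from the column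
`n+1` to the column `0`, which (reversed) is an open walk of `dualConfig ω` inside `B_n`
(`dual_mem_LR_of_notMem`).

Imports only landed PercRepro0 modules (which import Mathlib). No instances, no notation, no axioms.
-/

namespace Summit.Ventures.PercRepro0.DualCrossing

open Summit.Ventures.PercRepro0.Defs Summit.Ventures.PercRepro0.Crossing
  Summit.Ventures.PercRepro0.DualMap Summit.Ventures.PercRepro0.EdgeParity
  Summit.Ventures.PercRepro0.DualCut
open scoped Classical

variable {n : ℕ} {ω : Config 2}

/-! ## (iii)–(v) Degree parities -/

/-- (iii) Interior vertices `1 ≤ a ≤ n`, `0 ≤ b ≤ n` have even degree in the dual cut. -/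
theorem even_edeg_interior {a b : ℤ} (ha0 : 1 ≤ a) (ha1 : a ≤ n) (hb0 : 0 ≤ b) (hb1 : b ≤ n) :
    Even (edeg (dualCut n ω) (pt a b)) := by
  rw [edeg_dualCut]
  have hA : pt b (a - 1) ∈ rect n := pt_mem_rect.2 ⟨hb0, by omega, by omega, by omega⟩
  have hB : pt (b + 1) (a - 1) ∈ rect n := pt_mem_rect.2 ⟨by omega, by omega, by omega, by omega⟩
  have hC : pt (b + 1) a ∈ rect n := pt_mem_rect.2 ⟨by omega, by omega, by omega, by omega⟩
  have hD : pt b a ∈ rect n := pt_mem_rect.2 ⟨hb0, by omega, by omega, by omega⟩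
  rw [ind_eq_of_mem (h_mem_bonds b (a - 1)) hA hB,
    ind_eq_of_mem (by have := v_mem_bonds (b + 1) (a - 1); rwa [sub_add_cancel] at this) hB hC,
    ind_eq_of_mem (h_mem_bonds b a) hD hC,
    ind_eq_of_mem (by have := v_mem_bonds b (a - 1); rwa [sub_add_cancel] at this) hA hD]
  exact even_xor_cycle _ _ _ _

/-- (iv) The degree of `(n+1, b)`, `0 ≤ b ≤ n`: the switch indicator of the top edge `t_b = {(b,n),(b+1,n)}`. -/
theorem edeg_top {b : ℤ} (hb0 : 0 ≤ b) (hb1 : b ≤ n) :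
    edeg (dualCut n ω) (pt ((n : ℤ) + 1) b) =
      if Xor (pt b n ∈ reach n ω) (pt (b + 1) n ∈ reach n ω) then 1 else 0 := by
  rw [edeg_dualCut, add_sub_cancel_right]
  rw [ind_eq_zero_of_notMem (v := pt (b + 1) ((n : ℤ) + 1)) (Or.inr (by rw [pt_mem_rect]; omega)),
    ind_eq_zero_of_notMem (u := pt b ((n : ℤ) + 1)) (Or.inl (by rw [pt_mem_rect]; omega)),
    ind_eq_zero_of_notMem (v := pt b ((n : ℤ) + 1)) (Or.inr (by rw [pt_mem_rect]; omega)),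
    ind_eq_of_mem (h_mem_bonds b n) (pt_mem_rect.2 ⟨hb0, by omega, by omega, by omega⟩)
      (pt_mem_rect.2 ⟨by omega, by omega, by omega, by omega⟩)]
  simp

/-- (iv) The degree of `(0, b)`, `0 ≤ b ≤ n`: the switch indicator of the bottom edge `u_b = {(b,0),(b+1,0)}`. -/
theorem edeg_bottom {b : ℤ} (hb0 : 0 ≤ b) (hb1 : b ≤ n) :
    edeg (dualCut n ω) (pt 0 b) =
      if Xor (pt b 0 ∈ reach n ω) (pt (b + 1) 0 ∈ reach n ω) then 1 else 0 := by
  rw [edeg_dualCut, zero_sub]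
  rw [ind_eq_zero_of_notMem (u := pt b (-1)) (Or.inl (by rw [pt_mem_rect]; omega)),
    ind_eq_zero_of_notMem (u := pt (b + 1) (-1)) (Or.inl (by rw [pt_mem_rect]; omega)),
    ind_eq_zero_of_notMem (u := pt b (-1)) (Or.inl (by rw [pt_mem_rect]; omega)),
    ind_eq_of_mem (h_mem_bonds b 0) (pt_mem_rect.2 ⟨hb0, by omega, by omega, by omega⟩)
      (pt_mem_rect.2 ⟨by omega, by omega, by omega, by omega⟩)]
  simp

/-- Vertices outside `B_n` have degree `0` in the dual cut (when `ω ∉ LR_n`). -/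
theorem edeg_eq_zero_of_notMem_rect (hLR : ω ∉ LR n) {v : Vertex 2} (hv : v ∉ rect n) :
    edeg (dualCut n ω) v = 0 := by
  rw [edeg, Finset.card_eq_zero, Finset.filter_eq_empty_iff]
  intro e he hve
  exact hv (dualCut_mem_rect hLR he v hve)

/-! ## (vi) Extraction of the dual crossing -/

/-- Every vertex of a walk is its start or an endpoint of one of its edges. -/
theorem eq_or_mem_edges {V : Type*} {G : SimpleGraph V} {u v : V} (w : G.Walk u v) (z : V)
    (hz : z ∈ w.support) : z = u ∨ ∃ e ∈ w.edges, z ∈ e := by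
  induction w with
  | nil =>
    rw [SimpleGraph.Walk.support_nil, List.mem_singleton] at hz
    exact Or.inl hz
  | @cons a b c hab p ih =>
    rw [SimpleGraph.Walk.support_cons, List.mem_cons] at hz
    rcases hz with rfl | hz
    · exact Or.inl rfl
    · rcases ih hz with rfl | ⟨e, he, hze⟩
      · exact Or.inr ⟨s(a, z), by rw [SimpleGraph.Walk.edges_cons]; exact List.mem_cons_self, by simp⟩
      · exact Or.inr ⟨e, by rw [SimpleGraph.Walk.edges_cons]; exact List.mem_cons_of_mem _ he, hze⟩

/-- The column `n+1` of `B_n` as a finset (`T*_n` through `ψ`). -/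
noncomputable def topF (n : ℕ) : Finset (Vertex 2) :=
  (Finset.range (n + 1)).image fun b : ℕ => pt ((n : ℤ) + 1) b

/-- The column `0` of `B_n` as a finset (`Bot*_n` through `ψ`). -/
noncomputable def botF (n : ℕ) : Finset (Vertex 2) :=
  (Finset.range (n + 1)).image fun b : ℕ => pt 0 b

/-- `topF` is the right column. -/
theorem mem_topF {v : Vertex 2} : v ∈ topF n ↔ v ∈ rightCol n := by
  rw [topF, Finset.mem_image]
  constructor
  · rintro ⟨b, hb, rfl⟩
    rw [Finset.mem_range] at hb
    exact pt_mem_rightCol.2 ⟨rfl, by omega, by omega⟩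
  · intro hv
    obtain ⟨h0, h1, h2⟩ := hv
    refine ⟨(v 1).toNat, Finset.mem_range.2 (by omega), ?_⟩
    exact (eq_pt_of h0 (by omega)).symm

/-- `botF` is the left column. -/
theorem mem_botF {v : Vertex 2} : v ∈ botF n ↔ v ∈ leftCol n := by
  rw [botF, Finset.mem_image]
  constructor
  · rintro ⟨b, hb, rfl⟩
    rw [Finset.mem_range] at hb
    exact pt_mem_leftCol.2 ⟨rfl, by omega, by omega⟩
  · intro hv
    obtain ⟨h0, h1, h2⟩ := hv
    refine ⟨(v 1).toNat, Finset.mem_range.2 (by omega), ?_⟩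
    exact (eq_pt_of h0 (by omega)).symm

/-- (iii)–(iv): every odd-degree vertex of the dual cut lies in the column `n+1` or in the column `0`. -/
theorem mem_topF_or_botF_of_odd (hLR : ω ∉ LR n) (v : Vertex 2) (hodd : Odd (edeg (dualCut n ω) v)) :
    v ∈ topF n ∨ v ∈ botF n := by
  by_cases hv : v ∈ rect n
  · obtain ⟨h0, h1, h2, h3⟩ := hv
    rw [eq_pt v] at hodd ⊢
    by_cases ha0 : v 0 = 0
    · right
      rw [mem_botF, pt_mem_leftCol]
      exact ⟨ha0, h2, h3⟩
    by_cases ha1 : v 0 = n + 1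
    · left
      rw [mem_topF, pt_mem_rightCol]
      exact ⟨ha1, h2, h3⟩
    exfalso
    exact (Nat.not_even_iff_odd.2 hodd) (even_edeg_interior (by omega) (by omega) h2 h3)
  · rw [edeg_eq_zero_of_notMem_rect hLR hv] at hodd
    exact absurd hodd (by decide)

/-- (v): the column `n+1` contains an odd number of odd-degree vertices of the dual cut. -/
theorem odd_card_top (hLR : ω ∉ LR n) :
    Odd ((topF n).filter fun v => Odd (edeg (dualCut n ω) v)).card := by
  rw [Finset.card_filter, topF, Finset.sum_image]
  · have h : ∀ b ∈ Finset.range (n + 1),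
        (if Odd (edeg (dualCut n ω) (pt ((n : ℤ) + 1) b)) then 1 else 0) =
          (if Xor (pt (b : ℤ) n ∈ reach n ω) (pt ((b : ℤ) + 1) n ∈ reach n ω) then 1 else 0) := by
      intro b hb
      rw [Finset.mem_range] at hb
      rw [edeg_top (by omega) (by omega)]
      by_cases hx : Xor (pt (b : ℤ) n ∈ reach n ω) (pt ((b : ℤ) + 1) n ∈ reach n ω)
      · simp [hx]
      · simp [hx]
    rw [Finset.sum_congr rfl h]
    have := odd_switch_count (fun i : ℕ => pt (i : ℤ) n ∈ reach n ω) (n + 1)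
      (leftCol_subset_reach (pt_mem_leftCol.2 ⟨rfl, by omega, le_refl _⟩))
      (by
        push_cast
        exact rightCol_notMem_reach hLR (pt_mem_rightCol.2 ⟨rfl, by omega, le_refl _⟩))
    simpa only [Nat.cast_add, Nat.cast_one] using this
  · intro b _ b' _ h
    have := (pt_injective2 h).2
    exact_mod_cast this

/-- **P6 Lemma 3.1, the «at least one» half**: if `ω ∉ LR_n` then the dual configuration crosses `B_n`. -/
theorem dual_mem_LR_of_notMem (hLR : ω ∉ LR n) : dualConfig ω ∈ LR n := by
  have hE : ∀ e ∈ dualCut n ω, ¬ e.IsDiag := fun e he =>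
    SimpleGraph.not_isDiag_of_mem_edgeSet _ (dualCut_subset_bonds he)
  obtain ⟨t, ht, b, hb, hreach⟩ := exists_reachable_of_odd (dualCut n ω) hE (topF n) (botF n)
    (mem_topF_or_botF_of_odd hLR) (odd_card_top hLR)
  obtain ⟨w⟩ := hreach
  -- the walk uses edges of the dual cut: open bonds of `dualConfig ω`
  have hedges : ∀ e ∈ w.edges, e ∈ (openGraph 2 (dualConfig ω)).edgeSet := by
    intro e he
    have h := w.edges_subset_edgeSet he
    rw [SimpleGraph.edgeSet_fromEdgeSet] at h
    obtain ⟨h1, h2⟩ := h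
    rw [openGraph, SimpleGraph.edgeSet_fromEdgeSet]
    exact ⟨⟨dualCut_subset_dualConfig h1, dualCut_subset_bonds h1⟩, h2⟩
  have hsupp : ∀ z ∈ w.support, z ∈ rect n := by
    intro z hz
    rcases eq_or_mem_edges w z hz with rfl | ⟨e, he, hze⟩
    · exact rightCol_subset_rect n (mem_topF.1 ht)
    · have h := w.edges_subset_edgeSet he
      rw [SimpleGraph.edgeSet_fromEdgeSet] at h
      exact dualCut_mem_rect hLR h.1 z hze
  refine ⟨b, mem_botF.1 hb, t, mem_topF.1 ht, (w.transfer (openGraph 2 (dualConfig ω)) hedges).reverse, ?_⟩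
  intro z hz
  rw [SimpleGraph.Walk.support_reverse, List.mem_reverse, SimpleGraph.Walk.support_transfer] at hz
  exact hsupp z hz

/-- **P6(a), «at least one»** (P6-dualcrossing-p1-v1 Lemma 3.1 through `ψ`): every configuration crosses
`B_n` from left to right, or its dual configuration does. -/
theorem LR_or_dual (n : ℕ) (ω : Config 2) : ω ∈ LR n ∨ dualConfig ω ∈ LR n := by
  by_cases h : ω ∈ LR n
  · exact Or.inl h
  · exact Or.inr (dual_mem_LR_of_notMem h)

end Summit.Ventures.PercRepro0.DualCrossing
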